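import Mathlib
import HarnessLib

/-!
# Flat closed subschemes over a domain are the closures of their generic fibres — the affine heart of EGA IV₂ 2.8.5
(Grothendieck, *ÉGA* IV₂ (Publ. Math. IHÉS 24, 1965), Prop. 2.8.5; The Stacks Project, Tag 0AUW; Görtz–Wedhorn, *Algebraic
Geometry I*, Prop. 14.14 (schematic closure of the generic fibre))

Topic `RingTheory/Flat`; namespace `Literature.RingTheory.Flat`.  THEOREMS ONLY (no definition, no instance, no notation, no named fact,
no `sorry`); Mathlib-only.  Cell `pub/hodgecm-mathlib` (D-0151), FLOOR 0, programme F0P5a (crux item stmt-HodgeConjecture-24832; PLAN v4 §2∕§4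
row G2 «finite flat subgroup closure», part (a): the ALGEBRA half — generic, road-independent capital for the P6 roads R-RSZ L4.1 ∕ (γ2) ∕ L5.4 and
ROAD P″ §4; changes no count).

SETTING.  `R` a commutative ring (a domain ∕ Dedekind domain ∕ valuation ring in the flatness clauses), `A` a commutative `R`-algebra (think
`A = Γ(X, 𝒪_X)` for an affine `X → Spec R`), and `B` a localization of `A` at the image `M` of the non-zero-divisors `R⁰` (think
`B = K ⊗_R A = Γ(X_K, 𝒪)`, the GENERIC FIBRE; any `[IsLocalization (Algebra.algebraMapSubmonoid A (nonZeroDivisors R)) B]`).  A closed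
subscheme `V(I) ⊆ X` has generic fibre `V(I·B)`; the scheme-theoretic closure of a closed subscheme `V(J) ⊆ X_K` is `V(J ∩ A)`.
«`V(I)` FLAT over `R`» is, over a Dedekind domain or a valuation ring, «`A ⧸ I` has no `R⁰`-torsion» (Stacks 0AUW, Mathlib ★
`IsDedekindDomain.flat_iff_torsion_eq_bot`, ★ `Module.Flat.flat_iff_torsion_eq_bot_of_isBezout`), and over any `R` flatness implies it
(★ `Module.Flat.isSMulRegular_of_nonZeroDivisors`).  The «no `R⁰`-torsion» condition on `A ⧸ I` is stated here in ideal currency as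
SATURATION: `∀ r ∈ R⁰, ∀ a, r • a ∈ I → a ∈ I`.

* §1 `forall_smul_mem_imp_of_isTorsionFree` ∕ `isTorsionFree_quotient_of_forall_smul_mem_imp` — saturation ⟺ `Module.IsTorsionFree R (A ⧸ I)`
  (any commutative `R`); `forall_smul_mem_imp_of_flat` — FLAT ⇒ saturated (any `R`).
* §2 **`comap_map_eq_self_of_forall_smul_mem_imp`** — a saturated `I` is recovered from its generic fibre: `(I·B) ∩ A = I`
  (★ Mathlib `IsLocalization.algebraMap_mem_map_algebraMap_iff`); `map_comap_eq_self` — every `J ≤ B` is the generic fibre of its closure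
  `J ∩ A` (★ `IsLocalization.map_under`); `forall_smul_mem_imp_comap` — the closure `J ∩ A` is saturated; hence
  **`eq_of_forall_smul_mem_imp_of_map_eq`** — UNIQUENESS: two saturated ideals with the same generic fibre are equal — and
  `comap_injOn_eq_univ`-style bookkeeping: `comap` is a bijection from the ideals of `B` onto the saturated ideals of `A`
  (`comap_map_comap`, `exists_eq_comap_iff_forall_smul_mem_imp`).
* §3 the FLAT dress (EGA IV₂ 2.8.5 affine): over a Dedekind domain or a valuation ring, **`eq_of_flat_quotient_of_map_eq`** (two ideals
  with `R`-flat quotients and the same generic fibre coincide), **`flat_quotient_comap`** (the closure of any generic ideal has flat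
  quotient), `exists_unique_flat_quotient_map_eq` (∃! flat closed subscheme with prescribed generic fibre).

What is NOT here (row G2 (b)(c), separate files): the `Scheme`∕`IdealSheafData` dress over `Spec R` (★ `Resolution/StrictTransformFlatteningDedekind.
flat_ker_subschemeι_comp`, ★ `Resolution/SaturatedIdealSheaf` give the existence half scheme-theoretically) and «the closure of a subgroup
scheme is a subgroup scheme» (closure commutes with fibre products of flat closed subschemes).
HC_CM is proved only modulo the 7 printed citations until rung 0 closes; this file is generic commutative algebra and changes no count.

## References
* [EGAIV2] A. Grothendieck, J. Dieudonné, *Éléments de géométrie algébrique* IV₂, Publ. Math. IHÉS 24 (1965), Prop. 2.8.5 (flat closed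
  subschemes over a base of dimension 1 ↔ closed subschemes of the generic fibre; Prop. 2.8.1: closure of the generic fibre is flat).
* [StacksProject] The Stacks Project, Tag 0AUW (flat = torsion free over Dedekind domains), Tag 0539 (valuation rings ∕ Bézout).
* [GortzWedhorn2020] U. Görtz, T. Wedhorn, *Algebraic Geometry I*, 2nd ed. (2020), Prop. 14.14 and (14.12).
-/

set_option autoImplicit false

namespace Literature.RingTheory.Flat

open scoped nonZeroDivisors

section Saturation

variable {R A : Type*} [CommRing R] [CommRing A] [Algebra R A]

/-! ## §1 Saturation `∀ r ∈ R⁰, r • a ∈ I → a ∈ I` versus «`A ⧸ I` has no `R⁰`-torsion» versus flatness -/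

/-- `mk (r • a) = r • mk a` in `A ⧸ I` for the `R`-module structure coming from `Algebra R (A ⧸ I)`. [folklore] -/
private theorem mk_smul_eq (I : Ideal A) (r : R) (a : A) :
    Ideal.Quotient.mk I (r • a) = r • Ideal.Quotient.mk I a := by
  rw [Algebra.smul_def, Algebra.smul_def, map_mul, IsScalarTower.algebraMap_apply R A (A ⧸ I) r, Ideal.Quotient.algebraMap_eq]

/-- `r • a ∈ I ↔ r • (mk a) = 0` in `A ⧸ I`. [folklore] -/
private theorem smul_mem_iff_smul_mk_eq_zero (I : Ideal A) (r : R) (a : A) :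
    r • a ∈ I ↔ r • (Ideal.Quotient.mk I a) = 0 := by
  rw [← mk_smul_eq, Ideal.Quotient.eq_zero_iff_mem]

/-- **Torsion-free quotient ⇒ saturated**: if `A ⧸ I` is a torsion-free `R`-module then `r • a ∈ I` with `r ∈ R⁰` forces `a ∈ I`.
[cite: StacksProject, Tag 0AUW] -/
theorem forall_smul_mem_imp_of_isTorsionFree (I : Ideal A) [Module.IsTorsionFree R (A ⧸ I)]
    (r : R) (hr : r ∈ R⁰) (a : A) (h : r • a ∈ I) : a ∈ I := by
  rw [smul_mem_iff_smul_mk_eq_zero] at h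
  have hreg : IsSMulRegular (A ⧸ I) r :=
    Module.IsTorsionFree.isSMulRegular (isRegular_iff_mem_nonZeroDivisors.mpr hr)
  rw [← Ideal.Quotient.eq_zero_iff_mem]
  exact hreg (show r • Ideal.Quotient.mk I a = r • (0 : A ⧸ I) by rw [h, smul_zero])

/-- **Flat quotient ⇒ saturated** (any commutative `R`): scalar multiplication by a non-zero-divisor is injective on a flat module (★
`Module.Flat.isSMulRegular_of_nonZeroDivisors`). [cite: StacksProject, Tag 0AUW] -/
theorem forall_smul_mem_imp_of_flat (I : Ideal A) [Module.Flat R (A ⧸ I)]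
    (r : R) (hr : r ∈ R⁰) (a : A) (h : r • a ∈ I) : a ∈ I := by
  rw [smul_mem_iff_smul_mk_eq_zero] at h
  rw [← Ideal.Quotient.eq_zero_iff_mem]
  exact Module.Flat.isSMulRegular_of_nonZeroDivisors hr
    (show r • Ideal.Quotient.mk I a = r • (0 : A ⧸ I) by rw [h, smul_zero])

/-- **Saturated ⇒ torsion-free quotient** (a regular element of a commutative ring is exactly a non-zero-divisor, Mathlib
`isRegular_iff_mem_nonZeroDivisors`). [cite: StacksProject, Tag 0AUW] -/
theorem isTorsionFree_quotient_of_forall_smul_mem_imp (I : Ideal A)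
    (hI : ∀ r : R, r ∈ R⁰ → ∀ a : A, r • a ∈ I → a ∈ I) : Module.IsTorsionFree R (A ⧸ I) := by
  refine ⟨fun r hr x y hxy => ?_⟩
  obtain ⟨x, rfl⟩ := Ideal.Quotient.mk_surjective x
  obtain ⟨y, rfl⟩ := Ideal.Quotient.mk_surjective y
  rw [Ideal.Quotient.eq]
  refine hI r (isRegular_iff_mem_nonZeroDivisors.mp hr) (x - y) ?_
  rw [← Ideal.Quotient.eq_zero_iff_mem, mk_smul_eq, map_sub, smul_sub, sub_eq_zero]
  exact hxy

/-- Saturation ⟺ torsion-free quotient. [cite: StacksProject, Tag 0AUW] -/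
theorem isTorsionFree_quotient_iff_forall_smul_mem_imp (I : Ideal A) :
    Module.IsTorsionFree R (A ⧸ I) ↔ ∀ r : R, r ∈ R⁰ → ∀ a : A, r • a ∈ I → a ∈ I :=
  ⟨fun _ r hr a h => forall_smul_mem_imp_of_isTorsionFree I r hr a h, isTorsionFree_quotient_of_forall_smul_mem_imp I⟩

end Saturation

section GenericFibre

variable {R A B : Type*} [CommRing R] [CommRing A] [Algebra R A] [CommRing B] [Algebra A B]
  [hB : IsLocalization (Algebra.algebraMapSubmonoid A (nonZeroDivisors R)) B]

include hB

/-! ## §2 Generic fibre `I ↦ I·B` and closure `J ↦ J ∩ A`: a bijection onto the saturated ideals -/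

/-- **A saturated ideal is recovered from its generic fibre**: `(I·B) ∩ A = I` when `∀ r ∈ R⁰, r • a ∈ I → a ∈ I` (an element `a` with
`a ∈ I·B` satisfies `m a ∈ I` for some `m` in the image of `R⁰`, ★ `IsLocalization.algebraMap_mem_map_algebraMap_iff`).
[cite: EGAIV2, Prop. 2.8.5] [cite: GortzWedhorn2020, Prop. 14.14] -/
theorem comap_map_eq_self_of_forall_smul_mem_imp (I : Ideal A) (hI : ∀ r : R, r ∈ R⁰ → ∀ a : A, r • a ∈ I → a ∈ I) :
    (I.map (algebraMap A B)).comap (algebraMap A B) = I := by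
  refine le_antisymm (fun a ha => ?_) Ideal.le_comap_map
  rw [Ideal.mem_comap, IsLocalization.algebraMap_mem_map_algebraMap_iff (Algebra.algebraMapSubmonoid A (nonZeroDivisors R))] at ha
  obtain ⟨m, hm, hma⟩ := ha
  obtain ⟨r, hr, rfl⟩ := Submonoid.mem_map.mp hm
  exact hI r hr a (by rwa [Algebra.smul_def])

/-- **Every ideal of the generic fibre is the generic fibre of its closure**: `(J ∩ A)·B = J` (★ `IsLocalization.map_under`).
[cite: EGAIV2, Prop. 2.8.5] -/
theorem map_comap_eq_self (J : Ideal B) : (J.comap (algebraMap A B)).map (algebraMap A B) = J :=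
  IsLocalization.map_under (Algebra.algebraMapSubmonoid A (nonZeroDivisors R)) B J

/-- **The closure of a generic ideal is saturated**: `r • a ∈ J ∩ A` with `r ∈ R⁰` gives `a ∈ J ∩ A`, because `r` is a unit of `B`.
[cite: EGAIV2, Prop. 2.8.1] -/
theorem forall_smul_mem_imp_comap (J : Ideal B) (r : R) (hr : r ∈ R⁰) (a : A) (h : r • a ∈ J.comap (algebraMap A B)) :
    a ∈ J.comap (algebraMap A B) := by
  rw [Ideal.mem_comap] at h ⊢
  rw [Algebra.smul_def, map_mul] at h
  have hu : IsUnit (algebraMap A B (algebraMap R A r)) :=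
    IsLocalization.map_units B ⟨algebraMap R A r, Algebra.mem_algebraMapSubmonoid_of_mem ⟨r, hr⟩⟩
  exact (Ideal.unit_mul_mem_iff_mem J hu).mp h

/-- **UNIQUENESS — a saturated ideal is determined by its generic fibre**: two ideals of `A` with `R⁰`-torsion-free quotients and the
same extension to `B` are equal («a flat closed subscheme over a one-dimensional base is the closure of its generic fibre»).
[cite: EGAIV2, Prop. 2.8.5] [cite: GortzWedhorn2020, Prop. 14.14] -/
theorem eq_of_forall_smul_mem_imp_of_map_eq {I I' : Ideal A}
    (hI : ∀ r : R, r ∈ R⁰ → ∀ a : A, r • a ∈ I → a ∈ I) (hI' : ∀ r : R, r ∈ R⁰ → ∀ a : A, r • a ∈ I' → a ∈ I')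
    (h : I.map (algebraMap A B) = I'.map (algebraMap A B)) : I = I' := by
  rw [← comap_map_eq_self_of_forall_smul_mem_imp (R := R) (B := B) I hI,
    ← comap_map_eq_self_of_forall_smul_mem_imp (R := R) (B := B) I' hI', h]

/-- `comap ∘ map ∘ comap = comap`: the closure of the generic fibre of a closure is the closure. [cite: EGAIV2, Prop. 2.8.5] -/
theorem comap_map_comap (J : Ideal B) :
    (((J.comap (algebraMap A B)).map (algebraMap A B))).comap (algebraMap A B) = J.comap (algebraMap A B) := by
  rw [map_comap_eq_self (R := R)]

/-- **The saturated ideals are exactly the closures of generic ideals**: `I` is saturated iff `I = J ∩ A` for some (unique: `J = I·B`)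
ideal `J` of `B`. [cite: EGAIV2, Prop. 2.8.5] -/
theorem exists_eq_comap_iff_forall_smul_mem_imp (I : Ideal A) :
    (∃ J : Ideal B, I = J.comap (algebraMap A B)) ↔ ∀ r : R, r ∈ R⁰ → ∀ a : A, r • a ∈ I → a ∈ I := by
  constructor
  · rintro ⟨J, rfl⟩
    exact forall_smul_mem_imp_comap (R := R) J
  · intro hI
    exact ⟨I.map (algebraMap A B), (comap_map_eq_self_of_forall_smul_mem_imp (R := R) I hI).symm⟩

/-- `J ↦ J ∩ A` is injective on the ideals of the generic fibre (its left inverse is `I ↦ I·B`). [cite: EGAIV2, Prop. 2.8.5] -/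
theorem comap_injective : Function.Injective fun J : Ideal B => J.comap (algebraMap A B) := by
  intro J J' h
  have h' := congrArg (fun I : Ideal A => I.map (algebraMap A B)) h
  dsimp only at h'
  rwa [map_comap_eq_self (R := R) J, map_comap_eq_self (R := R) J'] at h'

/-! ## §3 The flat dress: over a Dedekind domain or a valuation ring, «flat quotient» replaces «saturated» (EGA IV₂ 2.8.5, affine form) -/

/-- **EGA IV₂ 2.8.5, uniqueness, over a DEDEKIND DOMAIN**: two ideals of `A` with `R`-FLAT quotients and the same generic fibre are equal.
[cite: EGAIV2, Prop. 2.8.5] [cite: StacksProject, Tag 0AUW] -/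
theorem eq_of_flat_quotient_of_map_eq {I I' : Ideal A} [Module.Flat R (A ⧸ I)] [Module.Flat R (A ⧸ I')]
    (h : I.map (algebraMap A B) = I'.map (algebraMap A B)) : I = I' :=
  eq_of_forall_smul_mem_imp_of_map_eq (R := R) (B := B) (forall_smul_mem_imp_of_flat I) (forall_smul_mem_imp_of_flat I') h

/-- **EGA IV₂ 2.8.1 ∕ 2.8.5, existence, over a DEDEKIND DOMAIN**: the closure `J ∩ A` of any ideal `J` of the generic fibre has `R`-FLAT
quotient (torsion-free ⇒ flat, ★ `IsDedekindDomain.flat_iff_torsion_eq_bot`), and its generic fibre is `J` (`map_comap_eq_self`).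
[cite: EGAIV2, Prop. 2.8.5] [cite: StacksProject, Tag 0AUW] -/
theorem flat_quotient_comap_of_isDedekindDomain [IsDedekindDomain R] (J : Ideal B) :
    Module.Flat R (A ⧸ J.comap (algebraMap A B)) := by
  haveI : Module.IsTorsionFree R (A ⧸ J.comap (algebraMap A B)) :=
    isTorsionFree_quotient_of_forall_smul_mem_imp _ (forall_smul_mem_imp_comap (R := R) J)
  infer_instance

/-- **The same over a VALUATION RING** (more generally a Bézout domain: torsion-free ⇒ flat, ★ `Module.Flat.flat_iff_torsion_eq_bot_of_isBezout`).
[cite: StacksProject, Tag 0539] [cite: EGAIV2, Prop. 2.8.5] -/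
theorem flat_quotient_comap_of_isBezout [IsBezout R] [IsDomain R] (J : Ideal B) :
    Module.Flat R (A ⧸ J.comap (algebraMap A B)) := by
  haveI : Module.IsTorsionFree R (A ⧸ J.comap (algebraMap A B)) :=
    isTorsionFree_quotient_of_forall_smul_mem_imp _ (forall_smul_mem_imp_comap (R := R) J)
  rw [Module.Flat.flat_iff_torsion_eq_bot_of_isBezout, ← Submodule.isTorsionFree_iff_torsion_eq_bot]
  infer_instance

/-- **EGA IV₂ 2.8.5 as a bijection statement, Dedekind base**: for every ideal `J` of the generic fibre there is EXACTLY ONE ideal `I` of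
`A` with `R`-flat quotient and generic fibre `J`, namely `I = J ∩ A` («flat closed subschemes of `X` ↔ closed subschemes of `X_K`»).
[cite: EGAIV2, Prop. 2.8.5] [cite: GortzWedhorn2020, Prop. 14.14] -/
theorem existsUnique_flat_quotient_map_eq_of_isDedekindDomain [IsDedekindDomain R] (J : Ideal B) :
    ∃! I : Ideal A, Module.Flat R (A ⧸ I) ∧ I.map (algebraMap A B) = J := by
  refine ⟨J.comap (algebraMap A B), ⟨flat_quotient_comap_of_isDedekindDomain (R := R) J, map_comap_eq_self (R := R) J⟩, ?_⟩
  rintro I ⟨hIf, hIJ⟩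
  haveI := hIf
  haveI := flat_quotient_comap_of_isDedekindDomain (R := R) (A := A) (B := B) J
  exact eq_of_flat_quotient_of_map_eq (R := R) (B := B) (hIJ.trans (map_comap_eq_self (R := R) J).symm)

/-- **The same over a VALUATION RING ∕ Bézout domain.** [cite: StacksProject, Tag 0539] [cite: EGAIV2, Prop. 2.8.5] -/
theorem existsUnique_flat_quotient_map_eq_of_isBezout [IsBezout R] [IsDomain R] (J : Ideal B) :
    ∃! I : Ideal A, Module.Flat R (A ⧸ I) ∧ I.map (algebraMap A B) = J := by
  refine ⟨J.comap (algebraMap A B), ⟨flat_quotient_comap_of_isBezout (R := R) J, map_comap_eq_self (R := R) J⟩, ?_⟩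
  rintro I ⟨hIf, hIJ⟩
  haveI := hIf
  haveI := flat_quotient_comap_of_isBezout (R := R) (A := A) (B := B) J
  exact eq_of_flat_quotient_of_map_eq (R := R) (B := B) (hIJ.trans (map_comap_eq_self (R := R) J).symm)

end GenericFibre

end Literature.RingTheory.Flat
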